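import Summits.Ventures.LatticeQCDFlow.Exactness.IMHCoupledUnbiasedEstimatorVariance
import Summits.Ventures.LatticeQCDFlow.Scoring.ReplicaChains
import HarnessLib

/-!
# A certified convergence diagnostic: the summed common-random-numbers corrections MEASURE the remaining burn-in bias of a run,
# `E[Σ_{n<N} D_{k+n}] = E f(Y_{k+N}) − E f(Y_k)` exactly, with mean-square error `≤ (1 − A)^k (c − a)² W(2W − 1) + ((1 − A)^{k+N}(c − a))²`

HONEST FRAMING: exact (Metropolis-corrected) sampling algorithms for lattice gauge theory;
figures of merit are autocorrelation/cost numbers at stated couplings and volumes; no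
continuum-physics claim.

Venture `LatticeQCDFlow` (cell pub-lqcd), topic `Exactness`; FANOUT row 30 (lean-1, GEN-37).  NEW WORK of the cell,
general state space; sequel to `Exactness/IMHCoupledUnbiasedEstimatorVariance` (this generation) with the Scoring row's replica
algebra.  Setting as there (`K = indepMH q w`, `W = w(x₀) = 1/A`, `r = 1 − A`; CRN pair kernel `K̂`; initial coupling `μ̂₀` one update
ahead in its first coordinate, `μ₂ = μ̂₀∘snd⁻¹`; `a ≤ f ≤ c` measurable; `S = Σ_{n<N} D_{k+n}`, `D_n = f(X′_n) − f(Y_n)`).  The quantity a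
practitioner cannot observe on one run — its remaining burn-in bias `β_k = π(f) − E f(Y_k)` — is the MEAN of an observable of the
coupled pair (printed counterpart, named only: the `L`-lag coupling diagnostics of Biswas–Jacob–Vanetti; here lag one, exact sampler,
explicit constants):

* §1 **`crnLag_correction_integral_eq`** — `E S = E f(Y_{k+N}) − E f(Y_k)` EXACTLY (`= β_k − β_{k+N}`); **`crnLag_correction_bias_abs_le`**
  — so `|E S − β_k| = |β_{k+N}| ≤ r^{k+N}(c − a)`: `S` is an estimator of the burn-in bias, unbiased up to the (geometrically smaller)
  bias at time `k + N`, exactly unbiased at `N = ∞`.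
* §2 **`integral_sub_sq_le_of_sq_le`** (bookkeeping: `E(S − θ)² ≤ E S² + (E S − θ)²`); **`crnLag_correction_sub_bias_sq_le`** — ITS
  MEAN-SQUARE ERROR ABOUT THE TRUE BIAS: `E(S − β_k)² ≤ r^k(c − a)²W(2W − 1) + (r^{k+N}(c − a))²` (the Variance file's second moment).
* §3 **`crnLag_correction_replicas_mse_le`** — `R` PAIRWISE INDEPENDENT coupled pairs from one common initial coupling: the average
  correction `S̄` estimates `β_k` with `E(S̄ − β_k)² ≤ [r^k(c − a)²W(2W − 1) + (r^{k+N}(c − a))²]/R + (1 − 1/R)(r^{k+N}(c − a))²` — THE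
  BURN-IN BIAS OF THE SAMPLER AT TIME `k` IS MEASURABLE TO ANY PRECISION WITHOUT A REFERENCE VALUE, at a cost of `R(k + N)` updates.
Reading (gauge files): run `R` coupled pairs of the exact gauge sampler from the production start; the average summed correction is
the remaining bias of the plaquette (or any bounded observable) at time `k`, with the displayed error bar.
NOT CLAIMED: a stopping rule or its validity; the variance of `S` exactly; anything for unbounded `f`.  No `sorry`, no new definitions,
nothing cited as a fact.
-/

noncomputable section

namespace Summit.Ventures.LatticeQCDFlow.Exactness

open MeasureTheory ProbabilityTheory Function Finset
open scoped ENNReal unitInterval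
open Summit.Ventures.LatticeQCDFlow.Scoring

variable {Ω : Type*} [MeasurableSpace Ω] {q : Measure Ω} [IsProbabilityMeasure q] {w : Ω → ℝ}

/-! ## §1 The mean of the summed corrections is a difference of burn-in biases -/

/-- **`E[Σ_{n<N} D_{k+n}] = (μ₂K^{k+N}) f − (μ₂K^k) f`** under the lag condition (`|f| ≤ C` measurable). [ours] -/
theorem crnLag_correction_integral_eq [Fact (Measurable w)] (hw0 : ∀ y, 0 < w y) (Khat : Kernel (Ω × Ω) (Ω × Ω))
    [IsMarkovKernel Khat]
    (hK : ∀ z : Ω × Ω, Khat z = (q.prod (volume : Measure unitInterval)).map (fun p : Ω × unitInterval =>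
      ((if (p.2 : ℝ) * w z.1 ≤ w p.1 then p.1 else z.1), (if (p.2 : ℝ) * w z.2 ≤ w p.1 then p.1 else z.2))))
    (μ₀ : Measure (Ω × Ω)) [IsProbabilityMeasure μ₀]
    (hlag : μ₀.map Prod.fst = (μ₀.map Prod.snd).bind (indepMH q w)) {f : Ω → ℝ} (hf : Measurable f) {C : ℝ}
    (hC : ∀ x, |f x| ≤ C) (k N : ℕ) :
    ∫ z, (∑ n ∈ Finset.range N, (f ((z (k + n)).1) - f ((z (k + n)).2)))
        ∂(Kernel.trajMeasure (X := fun _ : ℕ => Ω × Ω) μ₀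
          (fun n : ℕ => Khat.comap (fun h : (i : ↥(Finset.Iic n)) → Ω × Ω => h ⟨n, Finset.mem_Iic.2 le_rfl⟩)
            (measurable_pi_apply _))) =
      ∫ y, f y ∂((fun m : Measure Ω => m.bind (indepMH q w))^[k + N] (μ₀.map Prod.snd)) -
        ∫ y, f y ∂((fun m : Measure Ω => m.bind (indepMH q w))^[k] (μ₀.map Prod.snd)) := by
  set P := Kernel.trajMeasure (X := fun _ : ℕ => Ω × Ω) μ₀
        (fun n : ℕ => Khat.comap (fun h : (i : ↥(Finset.Iic n)) → Ω × Ω => h ⟨n, Finset.mem_Iic.2 le_rfl⟩)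
          (measurable_pi_apply _)) with hP
  have h1 := crnLag_truncated_integral_eq hw0 Khat hK μ₀ hlag hf hC k N
  have h2 := crnLag_integral_snd_eq hw0 Khat hK μ₀ hf hC k
  have hYi : Integrable (fun z : ℕ → Ω × Ω => f ((z k).2)) P :=
    integrable_of_bounded P (hf.comp (measurable_snd.comp (measurable_pi_apply k))) (fun z => hC _)
  have hDi : ∀ n, Integrable (fun z : ℕ → Ω × Ω => f ((z n).1) - f ((z n).2)) P := fun n =>
    integrable_of_bounded P ((hf.comp (measurable_fst.comp (measurable_pi_apply n))).sub
      (hf.comp (measurable_snd.comp (measurable_pi_apply n)))) (fun z => (abs_sub _ _).trans (add_le_add (hC _) (hC _)))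
  rw [← hP] at h1 h2
  rw [integral_add hYi (integrable_finsetSum _ fun n _ => hDi (k + n)), h2] at h1
  linarith

/-- **THE SUMMED CORRECTIONS ESTIMATE THE BURN-IN BIAS**: with `β_k = π(f) − E f(Y_k)`, `|E[Σ_{n<N} D_{k+n}] − β_k| ≤ r^{k+N}(c − a)`
(`a ≤ f ≤ c`, `w` maximal at `x₀`). [ours] -/
theorem crnLag_correction_bias_abs_le [Fact (Measurable w)] (hw0 : ∀ y, 0 < w y) {x₀ : Ω} (hmax : ∀ y, w y ≤ w x₀)
    [IsProbabilityMeasure (q.withDensity fun y => ENNReal.ofReal (w y))]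
    (Khat : Kernel (Ω × Ω) (Ω × Ω)) [IsMarkovKernel Khat]
    (hK : ∀ z : Ω × Ω, Khat z = (q.prod (volume : Measure unitInterval)).map (fun p : Ω × unitInterval =>
      ((if (p.2 : ℝ) * w z.1 ≤ w p.1 then p.1 else z.1), (if (p.2 : ℝ) * w z.2 ≤ w p.1 then p.1 else z.2))))
    (μ₀ : Measure (Ω × Ω)) [IsProbabilityMeasure μ₀]
    (hlag : μ₀.map Prod.fst = (μ₀.map Prod.snd).bind (indepMH q w)) {f : Ω → ℝ} (hf : Measurable f) {a c : ℝ}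
    (ha : ∀ x, a ≤ f x) (hc : ∀ x, f x ≤ c) (k N : ℕ) :
    |∫ z, (∑ n ∈ Finset.range N, (f ((z (k + n)).1) - f ((z (k + n)).2)))
        ∂(Kernel.trajMeasure (X := fun _ : ℕ => Ω × Ω) μ₀
          (fun n : ℕ => Khat.comap (fun h : (i : ↥(Finset.Iic n)) → Ω × Ω => h ⟨n, Finset.mem_Iic.2 le_rfl⟩)
            (measurable_pi_apply _))) -
      (∫ x, f x ∂(q.withDensity fun y => ENNReal.ofReal (w y)) -
        ∫ y, f y ∂((fun m : Measure Ω => m.bind (indepMH q w))^[k] (μ₀.map Prod.snd)))| ≤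
      (1 - (w x₀)⁻¹) ^ (k + N) * (c - a) := by
  haveI : IsProbabilityMeasure (μ₀.map Prod.snd) := Measure.isProbabilityMeasure_map measurable_snd.aemeasurable
  have hC : ∀ x, |f x| ≤ max |a| |c| := fun x => abs_le_max_abs_abs (ha x) (hc x)
  rw [crnLag_correction_integral_eq hw0 Khat hK μ₀ hlag hf hC k N]
  have h := integral_iterate_bind_indepMH_abs_le (q := q) Fact.out hw0 hmax (k + N) (μ₀.map Prod.snd) hf ha hc
  rw [show ∫ y, f y ∂((fun m : Measure Ω => m.bind (indepMH q w))^[k + N] (μ₀.map Prod.snd)) -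
      ∫ y, f y ∂((fun m : Measure Ω => m.bind (indepMH q w))^[k] (μ₀.map Prod.snd)) -
      (∫ x, f x ∂(q.withDensity fun y => ENNReal.ofReal (w y)) -
        ∫ y, f y ∂((fun m : Measure Ω => m.bind (indepMH q w))^[k] (μ₀.map Prod.snd))) =
      ∫ y, f y ∂((fun m : Measure Ω => m.bind (indepMH q w))^[k + N] (μ₀.map Prod.snd)) -
        ∫ x, f x ∂(q.withDensity fun y => ENNReal.ofReal (w y)) by ring]
  exact h

/-! ## §2 Its mean-square error about the true bias -/

omit [IsProbabilityMeasure q] in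
/-- Bookkeeping: `E(S − θ)² ≤ E S² + (E S − θ)²` for a bounded measurable `S` on a probability space
(`E(S − θ)² = Var S + (E S − θ)²` and `Var S ≤ E S²`). [ours, bookkeeping] -/
theorem integral_sub_sq_le_of_sq_le {α : Type*} [MeasurableSpace α] (P : Measure α) [IsProbabilityMeasure P]
    {S : α → ℝ} (hS : Measurable S) {B : ℝ} (hB : ∀ x, |S x| ≤ B) (θ : ℝ) :
    ∫ x, (S x - θ) ^ 2 ∂P ≤ ∫ x, S x ^ 2 ∂P + (∫ x, S x ∂P - θ) ^ 2 := by
  have hSi : Integrable S P := integrable_of_bounded P hS hB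
  have hS2i : Integrable (fun x => S x ^ 2) P :=
    integrable_of_bounded P (hS.pow_const 2) (C := B ^ 2) (fun x => by
      rw [abs_pow]; exact pow_le_pow_left₀ (abs_nonneg _) (hB x) 2)
  have hexp : ∀ x, (S x - θ) ^ 2 = S x ^ 2 - 2 * θ * S x + θ ^ 2 := fun x => by ring
  simp_rw [hexp]
  have h12 : Integrable (fun x => S x ^ 2 - 2 * θ * S x) P := hS2i.sub (hSi.const_mul _)
  rw [integral_add h12 (integrable_const _), integral_sub hS2i (hSi.const_mul _),
    integral_const_mul, integral_const, probReal_univ, one_smul]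
  nlinarith [sq_nonneg (∫ x, S x ∂P)]

/-- **THE MEAN-SQUARE ERROR OF THE BIAS ESTIMATE**: `E(Σ_{n<N} D_{k+n} − β_k)² ≤ r^k(c − a)²W(2W − 1) + (r^{k+N}(c − a))²`,
`β_k = π(f) − (μ₂K^k) f`, under the lag condition. [ours] -/
theorem crnLag_correction_sub_bias_sq_le [Fact (Measurable w)] (hw0 : ∀ y, 0 < w y) {x₀ : Ω} (hmax : ∀ y, w y ≤ w x₀)
    [IsProbabilityMeasure (q.withDensity fun y => ENNReal.ofReal (w y))]
    (Khat : Kernel (Ω × Ω) (Ω × Ω)) [IsMarkovKernel Khat]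
    (hK : ∀ z : Ω × Ω, Khat z = (q.prod (volume : Measure unitInterval)).map (fun p : Ω × unitInterval =>
      ((if (p.2 : ℝ) * w z.1 ≤ w p.1 then p.1 else z.1), (if (p.2 : ℝ) * w z.2 ≤ w p.1 then p.1 else z.2))))
    (μ₀ : Measure (Ω × Ω)) [IsProbabilityMeasure μ₀]
    (hlag : μ₀.map Prod.fst = (μ₀.map Prod.snd).bind (indepMH q w)) {f : Ω → ℝ} (hf : Measurable f) {a c : ℝ}
    (ha : ∀ x, a ≤ f x) (hc : ∀ x, f x ≤ c) (k N : ℕ) :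
    ∫ z, ((∑ n ∈ Finset.range N, (f ((z (k + n)).1) - f ((z (k + n)).2))) -
          (∫ x, f x ∂(q.withDensity fun y => ENNReal.ofReal (w y)) -
            ∫ y, f y ∂((fun m : Measure Ω => m.bind (indepMH q w))^[k] (μ₀.map Prod.snd)))) ^ 2
        ∂(Kernel.trajMeasure (X := fun _ : ℕ => Ω × Ω) μ₀
          (fun n : ℕ => Khat.comap (fun h : (i : ↥(Finset.Iic n)) → Ω × Ω => h ⟨n, Finset.mem_Iic.2 le_rfl⟩)
            (measurable_pi_apply _))) ≤
      (1 - (w x₀)⁻¹) ^ k * (c - a) ^ 2 * (w x₀ * (2 * w x₀ - 1)) + ((1 - (w x₀)⁻¹) ^ (k + N) * (c - a)) ^ 2 := by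
  set P := Kernel.trajMeasure (X := fun _ : ℕ => Ω × Ω) μ₀
        (fun n : ℕ => Khat.comap (fun h : (i : ↥(Finset.Iic n)) → Ω × Ω => h ⟨n, Finset.mem_Iic.2 le_rfl⟩)
          (measurable_pi_apply _)) with hP
  set θ := ∫ x, f x ∂(q.withDensity fun y => ENNReal.ofReal (w y)) -
    ∫ y, f y ∂((fun m : Measure Ω => m.bind (indepMH q w))^[k] (μ₀.map Prod.snd)) with hθ
  have hSm : Measurable (fun z : ℕ → Ω × Ω => ∑ n ∈ range N, (f ((z (k + n)).1) - f ((z (k + n)).2))) :=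
    Finset.measurable_sum _ fun n _ => (hf.comp (measurable_fst.comp (measurable_pi_apply (k + n)))).sub
      (hf.comp (measurable_snd.comp (measurable_pi_apply (k + n))))
  have hSb : ∀ z : ℕ → Ω × Ω, |∑ n ∈ range N, (f ((z (k + n)).1) - f ((z (k + n)).2))| ≤ N * (c - a) := by
    intro z
    refine (abs_sum_le_sum_abs _ _).trans ?_
    calc ∑ n ∈ range N, |f ((z (k + n)).1) - f ((z (k + n)).2)| ≤ ∑ n ∈ range N, (c - a) :=
          sum_le_sum fun n _ => by
            have h1 := ha ((z (k + n)).1); have h2 := hc ((z (k + n)).1)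
            have h3 := ha ((z (k + n)).2); have h4 := hc ((z (k + n)).2)
            exact abs_le.2 ⟨by linarith, by linarith⟩
      _ = N * (c - a) := by rw [sum_const, card_range, nsmul_eq_mul]
  have h1 := integral_sub_sq_le_of_sq_le P hSm hSb θ
  have h2 := crnLag_integral_sq_sum_le hw0 hmax Khat hK μ₀ hf ha hc k N
  have h3 := crnLag_correction_bias_abs_le hw0 hmax Khat hK μ₀ hlag hf ha hc k N
  rw [← hP] at h2 h3
  rw [← hθ] at h3
  have h4 : (∫ z, (∑ n ∈ range N, (f ((z (k + n)).1) - f ((z (k + n)).2))) ∂P - θ) ^ 2 ≤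
      ((1 - (w x₀)⁻¹) ^ (k + N) * (c - a)) ^ 2 := by
    rw [← sq_abs]
    exact pow_le_pow_left₀ (abs_nonneg _) h3 2
  linarith

/-! ## §3 Replicated pairs measure the burn-in bias to any precision -/

section Replicas

variable {Ω' : Type*} {mΩ' : MeasurableSpace Ω'} {μ : Measure Ω'} [IsProbabilityMeasure μ]
  {Z : ℕ → Ω' → (ℕ → Ω × Ω)} {R : ℕ}

/-- **THE BURN-IN BIAS IS MEASURABLE WITHOUT A REFERENCE VALUE**: `R ≥ 1` pairwise independent pair streams `Z_j`, each distributed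
as the CRN pair chain from ONE common initial coupling `ν` one update ahead in its first coordinate (`ν₂ = ν∘snd⁻¹`); the average summed
correction `S̄ = (1/R)Σ_j Σ_{n<N} D^{(j)}_{k+n}` satisfies
`E(S̄ − β_k)² ≤ [r^k(c − a)²W(2W − 1) + (r^{k+N}(c − a))²]/R + (1 − 1/R)(r^{k+N}(c − a))²`, `β_k = π(f) − (ν₂K^k) f`. [ours] -/
theorem crnLag_correction_replicas_mse_le [Fact (Measurable w)] (hw0 : ∀ y, 0 < w y) {x₀ : Ω} (hmax : ∀ y, w y ≤ w x₀)
    [IsProbabilityMeasure (q.withDensity fun y => ENNReal.ofReal (w y))]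
    (Khat : Kernel (Ω × Ω) (Ω × Ω)) [IsMarkovKernel Khat]
    (hK : ∀ z : Ω × Ω, Khat z = (q.prod (volume : Measure unitInterval)).map (fun p : Ω × unitInterval =>
      ((if (p.2 : ℝ) * w z.1 ≤ w p.1 then p.1 else z.1), (if (p.2 : ℝ) * w z.2 ≤ w p.1 then p.1 else z.2))))
    (ν : Measure (Ω × Ω)) [IsProbabilityMeasure ν] (hlag : ν.map Prod.fst = (ν.map Prod.snd).bind (indepMH q w))
    {f : Ω → ℝ} (hf : Measurable f) {a c : ℝ} (ha : ∀ x, a ≤ f x) (hc : ∀ x, f x ≤ c) (k N : ℕ) (hR : R ≠ 0)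
    (hZm : ∀ j, Measurable (Z j))
    (hlaw : ∀ j < R, μ.map (Z j) = Kernel.trajMeasure (X := fun _ : ℕ => Ω × Ω) ν
      (fun n : ℕ => Khat.comap (fun h : (i : ↥(Finset.Iic n)) → Ω × Ω => h ⟨n, Finset.mem_Iic.2 le_rfl⟩)
        (measurable_pi_apply _)))
    (hind : ∀ i < R, ∀ j < R, i ≠ j → IndepFun (Z i) (Z j) μ) :
    ∫ ω, (replicaMean (fun j ω => ∑ n ∈ range N, (f ((Z j ω (k + n)).1) - f ((Z j ω (k + n)).2))) R ω -
        (∫ x, f x ∂(q.withDensity fun y => ENNReal.ofReal (w y)) -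
          ∫ y, f y ∂((fun m : Measure Ω => m.bind (indepMH q w))^[k] (ν.map Prod.snd)))) ^ 2 ∂μ ≤
      ((1 - (w x₀)⁻¹) ^ k * (c - a) ^ 2 * (w x₀ * (2 * w x₀ - 1)) + ((1 - (w x₀)⁻¹) ^ (k + N) * (c - a)) ^ 2) / R +
        (1 - 1 / R) * ((1 - (w x₀)⁻¹) ^ (k + N) * (c - a)) ^ 2 := by
  set θ := ∫ x, f x ∂(q.withDensity fun y => ENNReal.ofReal (w y)) -
    ∫ y, f y ∂((fun m : Measure Ω => m.bind (indepMH q w))^[k] (ν.map Prod.snd)) with hθ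
  have hSm : Measurable (fun z : ℕ → Ω × Ω => ∑ n ∈ range N, (f ((z (k + n)).1) - f ((z (k + n)).2))) :=
    Finset.measurable_sum _ fun n _ => (hf.comp (measurable_fst.comp (measurable_pi_apply (k + n)))).sub
      (hf.comp (measurable_snd.comp (measurable_pi_apply (k + n))))
  have hSb : ∀ z : ℕ → Ω × Ω, |∑ n ∈ range N, (f ((z (k + n)).1) - f ((z (k + n)).2))| ≤ N * (c - a) := by
    intro z
    refine (abs_sum_le_sum_abs _ _).trans ?_
    calc ∑ n ∈ range N, |f ((z (k + n)).1) - f ((z (k + n)).2)| ≤ ∑ n ∈ range N, (c - a) :=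
          sum_le_sum fun n _ => by
            have h1 := ha ((z (k + n)).1); have h2 := hc ((z (k + n)).1)
            have h3 := ha ((z (k + n)).2); have h4 := hc ((z (k + n)).2)
            exact abs_le.2 ⟨by linarith, by linarith⟩
      _ = N * (c - a) := by rw [sum_const, card_range, nsmul_eq_mul]
  have hY2 : ∀ j < R, MemLp (fun ω => ∑ n ∈ range N, (f ((Z j ω (k + n)).1) - f ((Z j ω (k + n)).2))) 2 μ :=
    fun j _ => MemLp.of_bound ((hSm.comp (hZm j)).aestronglyMeasurable) (N * (c - a))
      (ae_of_all _ fun ω => by rw [Real.norm_eq_abs]; exact hSb (Z j ω))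
  have hb : ∀ j < R, |μ[fun ω => ∑ n ∈ range N, (f ((Z j ω (k + n)).1) - f ((Z j ω (k + n)).2))] - θ| ≤
      (1 - (w x₀)⁻¹) ^ (k + N) * (c - a) := by
    intro j hj
    have h := integral_comp_eq_of_map_eq (hZm j) (hlaw j hj) hSm
    rw [show μ[fun ω => ∑ n ∈ range N, (f ((Z j ω (k + n)).1) - f ((Z j ω (k + n)).2))] =
        ∫ ω, ∑ n ∈ range N, (f ((Z j ω (k + n)).1) - f ((Z j ω (k + n)).2)) ∂μ from rfl, h]
    exact crnLag_correction_bias_abs_le hw0 hmax Khat hK ν hlag hf ha hc k N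
  have hv : ∀ j < R, ∫ ω, (∑ n ∈ range N, (f ((Z j ω (k + n)).1) - f ((Z j ω (k + n)).2)) - θ) ^ 2 ∂μ ≤
      (1 - (w x₀)⁻¹) ^ k * (c - a) ^ 2 * (w x₀ * (2 * w x₀ - 1)) + ((1 - (w x₀)⁻¹) ^ (k + N) * (c - a)) ^ 2 := by
    intro j hj
    have h := integral_comp_eq_of_map_eq (hZm j) (hlaw j hj)
      (φ := fun z : ℕ → Ω × Ω => (∑ n ∈ range N, (f ((z (k + n)).1) - f ((z (k + n)).2)) - θ) ^ 2)
      ((hSm.sub measurable_const).pow_const 2)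
    rw [h]
    exact crnLag_correction_sub_bias_sq_le hw0 hmax Khat hK ν hlag hf ha hc k N
  have hcov : ∀ i < R, ∀ j < R, i ≠ j →
      cov[fun ω => ∑ n ∈ range N, (f ((Z i ω (k + n)).1) - f ((Z i ω (k + n)).2)),
        fun ω => ∑ n ∈ range N, (f ((Z j ω (k + n)).1) - f ((Z j ω (k + n)).2)); μ] = 0 :=
    fun i hi j hj hij => ((hind i hi j hj hij).comp hSm hSm).covariance_eq_zero (hY2 i hi) (hY2 j hj)
  exact integral_replicaMean_sub_sq_le
    (Y := fun j ω => ∑ n ∈ range N, (f ((Z j ω (k + n)).1) - f ((Z j ω (k + n)).2))) hR hY2 hcov hb hv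

end Replicas

end Summit.Ventures.LatticeQCDFlow.Exactness

end
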